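import Summits.ResolutionOfSingularities.ResolutionOfSingularities.Theorems.WeightedInvariantJOpenPresentationFlatCylinder
import Summits.ResolutionOfSingularities.ResolutionOfSingularities.Theorems.WeightedInvariantJFlatEssSmoothPoint
import Summits.ResolutionOfSingularities.ResolutionOfSingularities.Theorems.WeightedInvariantIota3Regimes
import HarnessLib

/-!
# (open″)≤3 for the pair of record `(ι₃ᵗ, J₃ᵗ)` — (o52-C) THE HEIGHT-ONE / MONOMIAL-TYPE BODY: at a position `F = v·uⁿ`
# (`u` a regular parameter, `v` a unit, `n ≥ 2`) the single parameter `U = (u)`, `W = (1)` presents `J₃ᵗ` on a basic open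
# and cuts out the top `ι₃ᵗ`-stratum exactly (door `HypersurfaceCentreConstruction`, stmt-ResolutionOfSingularities-19897;
# P3 rung clause h8 `JOpenPresentationForallSingLE 3 p Iota3.iotaFlatT Iota3.jFlatT`; DEAL (o52) SPLIT of res-L1-w43-plan-1,
# part (o52-C), hand res-D-brk-1)

Topic: `Summits/ResolutionOfSingularities/ResolutionOfSingularities/Theorems`. Helper for the door item
`HypersurfaceCentreConstruction` (stmt-ResolutionOfSingularities-19897, route `WeightedInvariant`), line `local-engine`
(L W4.3), def-free.  THE REGIME: the generic prime `P₀ᵗ` of the top `(ν ; ε ; τ)`-stratum of the position `S = A_𝔪`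
(regular, `dim S ≤ 3`) has HEIGHT ONE — equivalently (tree: `exists_eq_unit_mul_pow_of_iotaOrd_localization_eq_of_height_eq_one`,
p-`…IotaOrderEquimultipleCentre`) `F` is of MONOMIAL TYPE at `S`: `F/1 = v · gⁿ`, `v` a unit, `g ∈ 𝔪_S ∖ 𝔪_S²`, `n = ord F ≥ 2`.
This covers the DIVISORIAL positions of dimension 3 (res-type-073's `IsDivisorialPosition`, (R2) p529049), the monomial-type
positions of dimension 2, and every position of dimension 1.

THE BODY (`jOpenPresentationLE_body_monomial`): the literal ∃-body of `JOpenPresentationForallSingLE 3 p iotaFlatT jFlatT` at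
`(A, 𝔪, F)` with `N = 1`, `U = ![u]` (`u ∈ A` a numerator of `g`), `W = ![1]`: on a basic open `D(h) ∋ 𝔪`, at every prime
`𝔮 ∌ h` of local dimension `≤ 3`, `u ∈ 𝔮 ↔ (F ∈ 𝔪_{A_𝔮}² ∧ ι₃ᵗ (A_𝔮) F = ι₃ᵗ (A_𝔪) F)` and then
`J₃ᵗ (A_𝔮) F m = (u)^m A_𝔮`.  Route: the engine `JOpenLE3.jOpenPresentation_body_flat_of_stratumIff` (p-`…JOpenPresentationFlatCylinder`)
over the height-one prime `𝔭 = (g) ∩ A`, fed with (ι₀-IFF) — along `V(u) ∩ D(h)` the equation stays `unit · uⁿ` with `u` a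
regular parameter (cotangent spread), so `(ν ; ε ; τ) = (n ; 0 ; 0)` there (`iotaOrd_unit_mul_pow`,
`iotaEps_eq_zero_of_isMonomialType`, and `τ = 0`: in dimension `3` the `(ν ; ε)`-stratum `V(u)` is a surface, not a curve;
below dimension `3` there are no ties), while off `V(u)` the equation is a unit — and (J-PRES) — the `jContact`-cylinder over
a regular parameter is `(u)^m` (res-L1-w43-stub-3's `cylinder_comap_eq_pow_of_height_one`, p-`…JFlatEssSmoothCylinder`), the
primes `𝔭 A_𝔮` and `(u) A_𝔮` agreeing by height.

## Contents (sorry-free, standard axioms; NO definitions)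

* `eq_unit_mul_of_mul_eq` — `t x = a y` with `t, a` units ⇒ `x = (unit) · y`.
* `letters_of_eq_unit_mul_pow` — at `f = v gⁿ` in a regular local ring of dimension `≤ 3`: `ν = n`, `ε = 0`, `τ = 0`;
  `iotaOrdEpsTau_eq_of_eq_unit_mul_pow` — hence two such positions with the same `n` have the same `ι₀`.
* `map_atPrime_eq_span_of_height_one` — for `𝔭 = (g) ∩ A` (`g = u/1` a regular parameter of `A_𝔪`) and `𝔮 ⊇ 𝔭` with
  `u/1 ∈ 𝔪_{A_𝔮} ∖ 𝔪_{A_𝔮}²`: `𝔭 A_𝔮 = (u) A_𝔮`.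
* **`jOpenPresentationLE_body_monomial`** — the body above.

[OURS · L1 W4.3 · (o52-C)]  Replaces the role of NO printed item; NOT a statement of the manuscript
[claim: Hironaka2017, status: under-review]. AI work, weaker than expert review.  Pure commutative algebra; no named facts.

## References

* H. Matsumura, *Commutative Ring Theory* (1987), Thm. 13.5 (Krull), Thm. 14.2 / 14.3 (regular parameters, the order
  valuation), Thm. 20.3 (UFD). [Matsumura1987]
* res-L1-w43-plan-1, IOTA3-DESIGN v1.3 §8.4 row DIV and DEAL (o52) SPLIT (OURS, AI planning); res-type-073 (o38) (R2) (OURS).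
-/

noncomputable section

open IsLocalRing Literature.AlgebraicGeometry.Resolution
open Summit.ResolutionOfSingularities.ResolutionOfSingularities.Cruxes.HypersurfaceCentreConstruction.LocalEngine
open Summit.ResolutionOfSingularities.ResolutionOfSingularities.Cruxes.HypersurfaceCentreConstruction.LocalEngine.Iota3

set_option linter.dupNamespace false -- mandated namespace of this single-conjunct summit

namespace Summit.ResolutionOfSingularities.ResolutionOfSingularities.Theorems

namespace JOpenLE3

open ContactCylinder

/-! ## Units bookkeeping -/

/-- `t x = a y` with `t, a` units gives `x = w y` for the unit `w = t⁻¹ a`. [folklore] -/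
theorem eq_unit_mul_of_mul_eq {B : Type} [CommRing B] {t a x y : B} (ht : IsUnit t) (ha : IsUnit a) (h : t * x = a * y) :
    ∃ w : B, IsUnit w ∧ x = w * y := by
  refine ⟨↑ht.unit⁻¹ * a, (Units.isUnit _).mul ha, ?_⟩
  have h1 : (↑ht.unit⁻¹ : B) * t = 1 := ht.val_inv_mul
  calc x = (↑ht.unit⁻¹ * t) * x := by rw [h1, one_mul]
    _ = ↑ht.unit⁻¹ * (t * x) := by ring
    _ = ↑ht.unit⁻¹ * (a * y) := by rw [h]
    _ = ↑ht.unit⁻¹ * a * y := by ring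

/-! ## The letters at a monomial-type position -/

/-- **The stratifier at a monomial-type position**: for `f = v gⁿ` (`v` a unit, `g ∈ 𝔪 ∖ 𝔪²`, `n ≥ 1`) in a regular local ring
of Krull dimension `≤ 3`: `ν = n`, `ε = 0` (the equimultiple locus is the regular divisor `V(g)`), `τ = 0` (in dimension `3`
the top `(ν ; ε)`-stratum `V(g)` is a surface, `dim R ⧸ (g) = 2 ≠ 1`; below dimension `3` there are no ties).
[OURS · L1 W4.3 · (o52-C)] -/
theorem letters_of_eq_unit_mul_pow (R : Type) [CommRing R] [IsRegularLocalRing R] (hdim : ringKrullDim R ≤ 3)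
    {v g f : R} (hv : IsUnit v) (hg : g ∈ maximalIdeal R) (hg2 : g ∉ maximalIdeal R ^ 2) {n : ℕ} (hn : 0 < n)
    (hf : f = v * g ^ n) :
    iotaOrd R f = (n : ℕ) ∧ iotaEps R f = 0 ∧ iotaTau R f = 0 := by
  have hν : iotaOrd R f = (n : ℕ) := by rw [hf]; exact JFlatEssSmooth.iotaOrd_unit_mul_pow R hv hg hg2 n
  have hf𝔪 : f ∈ maximalIdeal R := by
    rw [hf]; exact Ideal.mul_mem_left _ _ (Ideal.pow_mem_of_mem _ hg n hn)
  have hfu : ¬ IsUnit f := fun h => IsLocalRing.notMem_maximalIdeal.mpr h hf𝔪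
  have hε : iotaEps R f = 0 := JFlatEssSmooth.iotaEps_eq_zero_of_isMonomialType R hfu ⟨v, g, n, hv, hg, hg2, hf⟩
  refine ⟨hν, hε, ?_⟩
  by_cases h3 : ringKrullDim R = 3
  · -- the `(ν ; ε)`-stratum is `V(g)`, a surface: `dim R ⧸ (g) = 2 ≠ 1`
    have hE : topStratum iotaOrdEps R f = {𝔮 | Ideal.span {g} ≤ 𝔮.asIdeal} := by
      rw [topStratum_iotaOrdEps_eq_topStratum_iotaOrd_of_iotaEps_eq_zero hf𝔪 hε,
        topStratum_iotaOrd_of_eq_unit_mul_pow hv hg hg2 hn hf]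
    haveI : (Ideal.span {g}).IsPrime := (IotaOrderStrat.strat_of_eq_unit_mul_pow hv hg hg2 hn hf).1
    have hP₀ : topStratumPrime iotaOrdEps R f = Ideal.span {g} := topStratumPrime_eq_of_topStratum_eq iotaOrdEps R f hE
    refine iotaTau_eq_zero_of_ringKrullDim_quotient_ne_one hdim ?_
    rw [hP₀]
    have hq := (quotient_span_singleton (R := R) hg hg2).2
    rw [h3] at hq
    intro h1
    rw [h1] at hq
    exact absurd hq (by decide)
  · exact iotaTau_eq_zero_of_ringKrullDim_ne_three hdim h3 f

/-- Two monomial-type positions with the same exponent (regular local rings of dimension `≤ 3`) carry the same stratifier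
`ι₀ = (ν ; ε ; τ) = (n ; 0 ; 0)`. [OURS · L1 W4.3 · (o52-C)] -/
theorem iotaOrdEpsTau_eq_of_eq_unit_mul_pow (R R' : Type) [CommRing R] [IsRegularLocalRing R] [CommRing R'] [IsRegularLocalRing R']
    (hdim : ringKrullDim R ≤ 3) (hdim' : ringKrullDim R' ≤ 3)
    {v g f : R} (hv : IsUnit v) (hg : g ∈ maximalIdeal R) (hg2 : g ∉ maximalIdeal R ^ 2)
    {v' g' f' : R'} (hv' : IsUnit v') (hg' : g' ∈ maximalIdeal R') (hg2' : g' ∉ maximalIdeal R' ^ 2)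
    {n : ℕ} (hn : 0 < n) (hf : f = v * g ^ n) (hf' : f' = v' * g' ^ n) :
    iotaOrdEpsTau R f = iotaOrdEpsTau R' f' := by
  obtain ⟨hν, hε, hτ⟩ := letters_of_eq_unit_mul_pow R hdim hv hg hg2 hn hf
  obtain ⟨hν', hε', hτ'⟩ := letters_of_eq_unit_mul_pow R' hdim' hv' hg' hg2' hn hf'
  rw [iotaOrdEpsTau_eq_iff, iotaOrdEps_eq_iff, hν, hν', hε, hε', hτ, hτ']
  exact ⟨⟨rfl, rfl⟩, rfl⟩


/-! ## The height-one prime `(g) ∩ A` extends to `(u) A_𝔮` along the stratum -/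

/-- For the height-one prime `𝔭 = (u/1) ∩ A` of a height-one prime `(u/1)` of `A_𝔪` (`u/1` not a unit, `A_𝔪` a domain) and
a prime `𝔮 ⊇ 𝔭` with `A_𝔮` regular and `u/1 ∈ 𝔪_{A_𝔮} ∖ 𝔪_{A_𝔮}²`: `𝔭 A_𝔮 = (u) A_𝔮` (both are primes of `A_𝔮`, one inside
the other, of height one). [cite: Matsumura1987, Thm. 13.5] -/
theorem map_atPrime_eq_span_of_height_one {A : Type} [CommRing A] [IsNoetherianRing A] (𝔪 : Ideal A) [𝔪.IsPrime]
    [IsDomain (Localization.AtPrime 𝔪)] (u : A)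
    (huu : ¬ IsUnit (algebraMap A (Localization.AtPrime 𝔪) u))
    [(Ideal.span {algebraMap A (Localization.AtPrime 𝔪) u}).IsPrime]
    (𝔮 : Ideal A) [𝔮.IsPrime] [IsRegularLocalRing (Localization.AtPrime 𝔮)]
    (h𝔭𝔮 : (Ideal.span {algebraMap A (Localization.AtPrime 𝔪) u}).comap (algebraMap A (Localization.AtPrime 𝔪)) ≤ 𝔮)
    (hu𝔮 : algebraMap A (Localization.AtPrime 𝔮) u ∈ maximalIdeal (Localization.AtPrime 𝔮))
    (hu𝔮2 : algebraMap A (Localization.AtPrime 𝔮) u ∉ maximalIdeal (Localization.AtPrime 𝔮) ^ 2) :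
    ((Ideal.span {algebraMap A (Localization.AtPrime 𝔪) u}).comap (algebraMap A (Localization.AtPrime 𝔪))).map
        (algebraMap A (Localization.AtPrime 𝔮)) =
      Ideal.span {algebraMap A (Localization.AtPrime 𝔮) u} := by
  set 𝔭 : Ideal A := (Ideal.span {algebraMap A (Localization.AtPrime 𝔪) u}).comap (algebraMap A (Localization.AtPrime 𝔪))
    with h𝔭
  haveI : 𝔭.IsPrime := Ideal.IsPrime.comap _
  haveI := isDomain_of_isRegularLocalRing (Localization.AtPrime 𝔮)
  -- the prime `(u) A_𝔮`, of height `≥ 1`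
  have hprime : Prime (algebraMap A (Localization.AtPrime 𝔮) u) := IsRegularLocalRing.prime_of_not_mem_sq hu𝔮 hu𝔮2
  haveI hP₁ : (Ideal.span {algebraMap A (Localization.AtPrime 𝔮) u}).IsPrime :=
    (Ideal.span_singleton_prime hprime.ne_zero).mpr hprime
  have h1 : 1 ≤ (Ideal.span {algebraMap A (Localization.AtPrime 𝔮) u}).height :=
    Ideal.one_le_height_span_singleton_of_mem_nonZeroDivisors (mem_nonZeroDivisors_of_ne_zero hprime.ne_zero)
  -- the prime `𝔭 A_𝔮`, of height `= ht 𝔭 = ht (u/1) ≤ 1`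
  haveI hP₂ : (𝔭.map (algebraMap A (Localization.AtPrime 𝔮))).IsPrime := isPrime_map_atPrime_of_le 𝔭 𝔮 h𝔭𝔮
  have hdisj : Disjoint (𝔮.primeCompl : Set A) (𝔭 : Set A) := Set.disjoint_left.mpr fun _ ha h𝔭a => ha (h𝔭𝔮 h𝔭a)
  have h2 : (𝔭.map (algebraMap A (Localization.AtPrime 𝔮))).height ≤ 1 := by
    rw [IsLocalization.height_map_of_disjoint 𝔮.primeCompl 𝔭 hdisj, h𝔭, ← Ideal.under_def,
      IsLocalization.height_under 𝔪.primeCompl]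
    exact Ideal.height_span_singleton_le_one huu
  -- `(u) A_𝔮 ≤ 𝔭 A_𝔮`, equal by height
  have hle : Ideal.span {algebraMap A (Localization.AtPrime 𝔮) u} ≤ 𝔭.map (algebraMap A (Localization.AtPrime 𝔮)) := by
    rw [Ideal.span_singleton_le_iff_mem]
    exact Ideal.mem_map_of_mem _ (Ideal.mem_comap.mpr (Ideal.mem_span_singleton_self _))
  exact (Ideal.eq_of_le_of_height_le _ hle (h2.trans h1)).symm

/-! ## (o52-C) the body -/

/-- **(open″)≤3 BODY AT A MONOMIAL-TYPE (height-one / divisorial) POSITION for the pair of record `(iotaFlatT, jFlatT)`.**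
Position: `k` perfect, `A` of finite type over `k`, `𝔪` a prime with `A_𝔪` regular of dimension `≤ 3`, and `F/1 = v · gⁿ` in
`A_𝔪` with `v` a unit, `g ∈ 𝔪 ∖ 𝔪²`, `n ≥ 2`.  Conclusion: the literal ∃-body of `JOpenPresentationForallSingLE 3 p iotaFlatT jFlatT`
at `(A, 𝔪, F)` — some `h ∉ 𝔪` and `N = 1`, `U = ![u]`, `W = ![1]` (`u ∈ A` a numerator of `g`), `U` in `𝔪 A_𝔪` with independent
differential, such that at every prime `𝔮 ∌ h` of local dimension `≤ 3`: `u ∈ 𝔮 ↔ (F ∈ 𝔪_{A_𝔮}² ∧ iotaFlatT (A_𝔮) F = iotaFlatT (A_𝔪) F)`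
and then `jFlatT (A_𝔮) F m = (u)^m A_𝔮` for every `m`. [OURS · L1 W4.3 · (o52-C)] -/
theorem jOpenPresentationLE_body_monomial
    (k : Type) [Field k] [PerfectField k] (A : Type) [CommRing A] [Algebra k A] [Algebra.FiniteType k A]
    (𝔪 : Ideal A) [𝔪.IsPrime] [IsRegularLocalRing (Localization.AtPrime 𝔪)]
    (hdim𝔪 : ringKrullDim (Localization.AtPrime 𝔪) ≤ 3) (F : A)
    {v g : Localization.AtPrime 𝔪} (hv : IsUnit v) (hg : g ∈ maximalIdeal (Localization.AtPrime 𝔪))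
    (hg2 : g ∉ maximalIdeal (Localization.AtPrime 𝔪) ^ 2) {n : ℕ} (hn : 2 ≤ n)
    (hF : algebraMap A (Localization.AtPrime 𝔪) F = v * g ^ n) :
    ∃ h : A, h ∉ 𝔪 ∧ ∃ (N : ℕ) (U : Fin N → A) (W : Fin N → ℕ), (∀ i, 0 < W i) ∧
      (∃ hU : ∀ i, algebraMap A (Localization.AtPrime 𝔪) (U i) ∈ maximalIdeal (Localization.AtPrime 𝔪),
        LinearIndependent (ResidueField (Localization.AtPrime 𝔪))
          (fun i => ((maximalIdeal (Localization.AtPrime 𝔪)).toCotangent ⟨_, hU i⟩ :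
            CotangentSpace (Localization.AtPrime 𝔪)))) ∧
      ∀ (𝔮 : Ideal A) [𝔮.IsPrime], h ∉ 𝔮 → ringKrullDim (Localization.AtPrime 𝔮) ≤ 3 →
        ((∀ i, U i ∈ 𝔮) ↔
          (algebraMap A (Localization.AtPrime 𝔮) F ∈ (maximalIdeal (Localization.AtPrime 𝔮)) ^ 2 ∧
            iotaFlatT (Localization.AtPrime 𝔮) (algebraMap A (Localization.AtPrime 𝔮) F) =
              iotaFlatT (Localization.AtPrime 𝔪) (algebraMap A (Localization.AtPrime 𝔪) F))) ∧
        ((∀ i, U i ∈ 𝔮) → ∀ m : ℕ,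
          jFlatT (Localization.AtPrime 𝔮) (algebraMap A (Localization.AtPrime 𝔮) F) m =
            (weightedMonomialIdeal U W m).map (algebraMap A (Localization.AtPrime 𝔮))) := by
  classical
  haveI : IsNoetherianRing A := Algebra.FiniteType.isNoetherianRing k A
  haveI := isDomain_of_isRegularLocalRing (Localization.AtPrime 𝔪)
  have hn0 : 0 < n := by omega
  -- STEP 0: a numerator `u ∈ A` of `g`: `g · s/1 = u/1`, so `u/1` is again a regular parameter and `F/1 = v₁ (u/1)ⁿ`
  obtain ⟨⟨u, s⟩, hus⟩ := IsLocalization.surj 𝔪.primeCompl g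
  simp only at hus
  have hsunit : IsUnit (algebraMap A (Localization.AtPrime 𝔪) (s : A)) := IsLocalization.map_units (Localization.AtPrime 𝔪) s
  have hu𝔪 : algebraMap A (Localization.AtPrime 𝔪) u ∈ maximalIdeal (Localization.AtPrime 𝔪) := by rw [← hus]; exact Ideal.mul_mem_right _ _ hg
  have hu2 : algebraMap A (Localization.AtPrime 𝔪) u ∉ maximalIdeal (Localization.AtPrime 𝔪) ^ 2 := by
    rw [← hus, mul_comm]
    exact fun h => hg2 ((Ideal.unit_mul_mem_iff_mem _ hsunit).mp h)
  obtain ⟨v₁, hv₁, hFu⟩ : ∃ v₁ : (Localization.AtPrime 𝔪), IsUnit v₁ ∧ algebraMap A (Localization.AtPrime 𝔪) F = v₁ * algebraMap A (Localization.AtPrime 𝔪) u ^ n := by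
    refine eq_unit_mul_of_mul_eq (hsunit.pow n) hv ?_
    rw [hF, ← hus, mul_pow]; ring
  have huunit : ¬ IsUnit (algebraMap A (Localization.AtPrime 𝔪) u) := fun h => IsLocalRing.notMem_maximalIdeal.mpr h hu𝔪
  have hu0 : algebraMap A (Localization.AtPrime 𝔪) u ≠ 0 := fun h => hu2 (by rw [h]; exact Ideal.zero_mem _)
  -- STEP 1: an `A`-level equation `c t F = c a uⁿ` with `c, t, a ∉ 𝔪` (clearing the denominator of `v₁ = a/t`)
  obtain ⟨⟨a, t⟩, hat⟩ := IsLocalization.surj 𝔪.primeCompl v₁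
  simp only at hat
  have htunit : IsUnit (algebraMap A (Localization.AtPrime 𝔪) (t : A)) := IsLocalization.map_units (Localization.AtPrime 𝔪) t
  have ha𝔪 : a ∉ 𝔪 := by
    have hau : IsUnit (algebraMap A (Localization.AtPrime 𝔪) a) := by rw [← hat]; exact hv₁.mul htunit
    exact fun h => (IsLocalization.AtPrime.isUnit_to_map_iff (Localization.AtPrime 𝔪) 𝔪 a).mp hau h
  have heqA : algebraMap A (Localization.AtPrime 𝔪) ((t : A) * F) = algebraMap A (Localization.AtPrime 𝔪) (a * u ^ n) := by
    rw [map_mul, map_mul, map_pow, hFu, ← hat]; ring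
  obtain ⟨c, hc⟩ := (IsLocalization.eq_iff_exists 𝔪.primeCompl (Localization.AtPrime 𝔪)).mp heqA
  -- STEP 2: the height-one centre `𝔭 = (u/1) ∩ A`
  have huprime : Prime (algebraMap A (Localization.AtPrime 𝔪) u) := IsRegularLocalRing.prime_of_not_mem_sq hu𝔪 hu2
  haveI hPL : (Ideal.span {algebraMap A (Localization.AtPrime 𝔪) u}).IsPrime := (Ideal.span_singleton_prime hu0).mpr huprime
  set 𝔭 : Ideal A := (Ideal.span {algebraMap A (Localization.AtPrime 𝔪) u}).comap (algebraMap A (Localization.AtPrime 𝔪)) with h𝔭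
  haveI : 𝔭.IsPrime := Ideal.IsPrime.comap _
  have hu𝔭 : u ∈ 𝔭 := Ideal.mem_comap.mpr (Ideal.mem_span_singleton_self _)
  have h𝔭𝔪 : 𝔭 ≤ 𝔪 := by
    intro x hx
    by_contra hx𝔪
    have hxu : IsUnit (algebraMap A (Localization.AtPrime 𝔪) x) := IsLocalization.map_units (Localization.AtPrime 𝔪) (⟨x, hx𝔪⟩ : 𝔪.primeCompl)
    exact hPL.ne_top (Ideal.eq_top_of_isUnit_mem _ (Ideal.mem_comap.mp hx) hxu)
  have h𝔭map : 𝔭.map (algebraMap A (Localization.AtPrime 𝔪)) = Ideal.span {algebraMap A (Localization.AtPrime 𝔪) u} := by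
    rw [h𝔭, ← Ideal.under_def]; exact IsLocalization.map_under 𝔪.primeCompl (Localization.AtPrime 𝔪) _
  have hdim𝔭 : ringKrullDim (Localization.AtPrime 𝔭) ≤ 2 := by
    rw [IsLocalization.AtPrime.ringKrullDim_eq_height 𝔭 (Localization.AtPrime 𝔭), h𝔭, ← Ideal.under_def,
      IsLocalization.height_under 𝔪.primeCompl]
    exact (WithBot.coe_le_coe.mpr (Ideal.height_span_singleton_le_one huunit)).trans (by decide)
  -- the single vector `![u]`
  have hU𝔪 : ∀ i, algebraMap A (Localization.AtPrime 𝔪) ((![u] : Fin 1 → A) i) ∈ maximalIdeal (Localization.AtPrime 𝔪) := fun i => by fin_cases i; exact hu𝔪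
  have hli𝔪 : LinearIndependent (ResidueField (Localization.AtPrime 𝔪)) (fun i => (maximalIdeal (Localization.AtPrime 𝔪)).toCotangent ⟨algebraMap A (Localization.AtPrime 𝔪) ((![u] : Fin 1 → A) i), hU𝔪 i⟩) := by
    rw [linearIndependent_unique_iff]
    intro h
    exact hu2 ((Ideal.toCotangent_eq_zero _ _).mp h)
  have hrange : Set.range (![u] : Fin 1 → A) = {u} := by ext y; simp [eq_comm]
  have hU𝔭 : (Ideal.span (Set.range (![u] : Fin 1 → A))).map (algebraMap A (Localization.AtPrime 𝔪)) = 𝔭.map (algebraMap A (Localization.AtPrime 𝔪)) := by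
    rw [hrange, h𝔭map, Ideal.map_span, Set.image_singleton]
  have h2 : (2 : Ordinal) ≤ iotaOrd (Localization.AtPrime 𝔪) (algebraMap A (Localization.AtPrime 𝔪) F) := by
    rw [(letters_of_eq_unit_mul_pow (Localization.AtPrime 𝔪) hdim𝔪 hv₁ hu𝔪 hu2 hn0 hFu).1]
    exact_mod_cast hn
  -- STEP 3: regularity of `A_𝔮` and `u/1 ∈ 𝔪_𝔮 ∖ 𝔪_𝔮²` spread from `𝔪`; the bridge `V(u) = V(𝔭)` near `𝔪`
  obtain ⟨f, hf𝔪, hspread⟩ := exists_notMem_forall_linearIndependent_toCotangent k 𝔪 (![u] : Fin 1 → A) hU𝔪 hli𝔪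
  obtain ⟨hb, hhb, hbridge⟩ := StratumIff.exists_forall_le_iff_comap_le 𝔪 (Ideal.span {u})
  have hcomap : ((Ideal.span {u}).map (algebraMap A (Localization.AtPrime 𝔪))).comap (algebraMap A (Localization.AtPrime 𝔪)) = 𝔭 := by
    rw [Ideal.map_span, Set.image_singleton]
  -- at `𝔮 ∈ V(u) ∩ D(c t a f)` of dimension ≤ 3: `A_𝔮` regular, `u/1` a regular parameter, `F/1 = (unit) (u/1)ⁿ`
  have hlocal : ∀ (𝔮 : Ideal A) [𝔮.IsPrime], ((c : A) * t * a * f) ∉ 𝔮 → u ∈ 𝔮 →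
      IsRegularLocalRing (Localization.AtPrime 𝔮) ∧
      algebraMap A (Localization.AtPrime 𝔮) u ∈ maximalIdeal (Localization.AtPrime 𝔮) ∧
      algebraMap A (Localization.AtPrime 𝔮) u ∉ maximalIdeal (Localization.AtPrime 𝔮) ^ 2 ∧
      ∃ w : Localization.AtPrime 𝔮, IsUnit w ∧
        algebraMap A (Localization.AtPrime 𝔮) F = w * algebraMap A (Localization.AtPrime 𝔮) u ^ n := by
    intro 𝔮 _ hh𝔮 hu𝔮
    have hc𝔮 : (c : A) ∉ 𝔮 := fun h => hh𝔮 (Ideal.mul_mem_right _ _ (Ideal.mul_mem_right _ _ (Ideal.mul_mem_right _ _ h)))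
    have ht𝔮 : (t : A) ∉ 𝔮 := fun h => hh𝔮 (Ideal.mul_mem_right _ _ (Ideal.mul_mem_right _ _ (Ideal.mul_mem_left _ _ h)))
    have ha𝔮 : a ∉ 𝔮 := fun h => hh𝔮 (Ideal.mul_mem_right _ _ (Ideal.mul_mem_left _ _ h))
    have hf𝔮 : f ∉ 𝔮 := fun h => hh𝔮 (Ideal.mul_mem_left _ _ h)
    obtain ⟨hreg, hU𝔮, hli𝔮⟩ := hspread 𝔮 hf𝔮 (fun i => by fin_cases i; exact hu𝔮)
    have hu𝔮' := hU𝔮 0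
    have hu𝔮2 : algebraMap A (Localization.AtPrime 𝔮) u ∉ maximalIdeal (Localization.AtPrime 𝔮) ^ 2 := by
      intro h
      rw [linearIndependent_unique_iff] at hli𝔮
      exact hli𝔮 ((Ideal.toCotangent_eq_zero _ _).mpr h)
    refine ⟨hreg, hu𝔮', hu𝔮2, ?_⟩
    have hunit : ∀ x : A, x ∉ 𝔮 → IsUnit (algebraMap A (Localization.AtPrime 𝔮) x) := fun x hx =>
      IsLocalization.map_units (Localization.AtPrime 𝔮) (⟨x, hx⟩ : 𝔮.primeCompl)
    refine eq_unit_mul_of_mul_eq ((hunit _ hc𝔮).mul (hunit _ ht𝔮)) ((hunit _ hc𝔮).mul (hunit _ ha𝔮)) ?_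
    have := congr_arg (algebraMap A (Localization.AtPrime 𝔮)) hc
    simp only [map_mul, map_pow] at this
    linear_combination this
  -- STEP 4: the engine
  have key := jOpenPresentation_body_flat_of_stratumIff k A 𝔪 hdim𝔪 F h2 𝔭 h𝔭𝔪 hdim𝔭 ![u] ![1] hU𝔭 hU𝔪 hli𝔪
    (h₀ := (c : A) * t * a * f) ?hh0 ?hpres (h₁ := (c : A) * t * a * f * hb) ?hh1 ?hiff
  case hh0 =>
    -- `c t a f ∉ 𝔪`
    intro hm
    rcases Ideal.IsPrime.mem_or_mem ‹𝔪.IsPrime› hm with hm | hm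
    · rcases Ideal.IsPrime.mem_or_mem ‹𝔪.IsPrime› hm with hm | hm
      · rcases Ideal.IsPrime.mem_or_mem ‹𝔪.IsPrime› hm with hm | hm
        · exact c.2 hm
        · exact t.2 hm
      · exact ha𝔪 hm
    · exact hf𝔪 hm
  case hpres =>
    -- (J-PRES): the `jContact`-cylinder over `𝔭 A_𝔮 = (u) A_𝔮` is `(u)^m`
    intro 𝔮 _ hh𝔮 h𝔭𝔮 hdim𝔮 hreg _ m
    haveI := hreg
    obtain ⟨-, hu𝔮, hu𝔮2, w, hw, hFw⟩ := hlocal 𝔮 hh𝔮 (h𝔭𝔮 hu𝔭)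
    haveI := isDomain_of_isRegularLocalRing (Localization.AtPrime 𝔮)
    haveI := isPrime_map_atPrime_of_le 𝔭 𝔮 h𝔭𝔮
    have hprime𝔮 : Prime (algebraMap A (Localization.AtPrime 𝔮) u) := IsRegularLocalRing.prime_of_not_mem_sq hu𝔮 hu𝔮2
    haveI : (Ideal.span {algebraMap A (Localization.AtPrime 𝔮) u}).IsPrime :=
      (Ideal.span_singleton_prime hprime𝔮.ne_zero).mpr hprime𝔮
    have heq := map_atPrime_eq_span_of_height_one 𝔪 u huunit 𝔮 h𝔭𝔮 hu𝔮 hu𝔮2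
    have hF0 : algebraMap A (Localization.AtPrime 𝔮) F ≠ 0 := by
      rw [hFw]; exact mul_ne_zero hw.ne_zero (pow_ne_zero n hprime𝔮.ne_zero)
    have hFu𝔮 : algebraMap A (Localization.AtPrime 𝔮) F ∈ Ideal.span {algebraMap A (Localization.AtPrime 𝔮) u} := by
      rw [hFw]; exact Ideal.mul_mem_left _ _ (Ideal.pow_mem_of_mem _ (Ideal.mem_span_singleton_self _) n hn0)
    rw [← cylinderAt_localization jContact jContact_isoInvariant A 𝔭 𝔮 h𝔭𝔮 F m, cylinderAt_congr jContact _ heq _ m,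
      cylinderAt_def, JFlatEssSmooth.cylinder_comap_eq_pow_of_height_one _ _ hu𝔮 hu𝔮2 _ hF0 hFu𝔮 m,
      show (![1] : Fin 1 → ℕ) = fun _ => 1 from funext fun i => by fin_cases i; rfl,
      Theorems.weightedMonomialIdeal_one_eq_pow, Ideal.map_pow, Ideal.map_span, hrange, Set.image_singleton]
  case hh1 =>
    -- `c t a f hb ∉ 𝔪`
    intro hm
    rcases Ideal.IsPrime.mem_or_mem ‹𝔪.IsPrime› hm with hm | hm
    · rcases Ideal.IsPrime.mem_or_mem ‹𝔪.IsPrime› hm with hm | hm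
      · rcases Ideal.IsPrime.mem_or_mem ‹𝔪.IsPrime› hm with hm | hm
        · rcases Ideal.IsPrime.mem_or_mem ‹𝔪.IsPrime› hm with hm | hm
          · exact c.2 hm
          · exact t.2 hm
        · exact ha𝔪 hm
      · exact hf𝔪 hm
    · exact hhb hm
  case hiff =>
    -- (ι₀-IFF) on `D(c t a f hb) ∩ {dim ≤ 3}`
    intro 𝔮 _ hh𝔮 hdim𝔮
    have hh𝔮' : (c : A) * t * a * f ∉ 𝔮 := fun h => hh𝔮 (Ideal.mul_mem_right _ _ h)
    have hhb𝔮 : hb ∉ 𝔮 := fun h => hh𝔮 (Ideal.mul_mem_left _ _ h)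
    have hbr : u ∈ 𝔮 ↔ 𝔭 ≤ 𝔮 := by
      rw [← Ideal.span_singleton_le_iff_mem, hbridge 𝔮 hhb𝔮, hcomap]
    constructor
    · intro h𝔭𝔮
      obtain ⟨hreg, hu𝔮, hu𝔮2, w, hw, hFw⟩ := hlocal 𝔮 hh𝔮' (h𝔭𝔮 hu𝔭)
      haveI := hreg
      refine ⟨?_, iotaOrdEpsTau_eq_of_eq_unit_mul_pow _ _ hdim𝔮 hdim𝔪 hw hu𝔮 hu𝔮2 hv₁ hu𝔪 hu2 hn0 hFw hFu⟩
      rw [hFw]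
      exact Ideal.mul_mem_left _ _ (Ideal.pow_le_pow_right hn (Ideal.pow_mem_pow hu𝔮 n))
    · rintro ⟨hF2, -⟩
      rw [← hbr]
      by_contra hu𝔮
      have huu : IsUnit (algebraMap A (Localization.AtPrime 𝔮) u) :=
        IsLocalization.map_units (Localization.AtPrime 𝔮) (⟨u, hu𝔮⟩ : 𝔮.primeCompl)
      have hc𝔮 : (c : A) ∉ 𝔮 := fun h => hh𝔮' (Ideal.mul_mem_right _ _ (Ideal.mul_mem_right _ _ (Ideal.mul_mem_right _ _ h)))
      have ha𝔮 : a ∉ 𝔮 := fun h => hh𝔮' (Ideal.mul_mem_right _ _ (Ideal.mul_mem_left _ _ h))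
      have ht𝔮 : (t : A) ∉ 𝔮 := fun h => hh𝔮' (Ideal.mul_mem_right _ _ (Ideal.mul_mem_right _ _ (Ideal.mul_mem_left _ _ h)))
      have hunit : ∀ x : A, x ∉ 𝔮 → IsUnit (algebraMap A (Localization.AtPrime 𝔮) x) := fun x hx =>
        IsLocalization.map_units (Localization.AtPrime 𝔮) (⟨x, hx⟩ : 𝔮.primeCompl)
      obtain ⟨w, hw, hFw⟩ : ∃ w : Localization.AtPrime 𝔮, IsUnit w ∧
          algebraMap A (Localization.AtPrime 𝔮) F = w * algebraMap A (Localization.AtPrime 𝔮) u ^ n := by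
        refine eq_unit_mul_of_mul_eq ((hunit _ hc𝔮).mul (hunit _ ht𝔮)) ((hunit _ hc𝔮).mul (hunit _ ha𝔮)) ?_
        have := congr_arg (algebraMap A (Localization.AtPrime 𝔮)) hc
        simp only [map_mul, map_pow] at this
        linear_combination this
      have hFunit : IsUnit (algebraMap A (Localization.AtPrime 𝔮) F) := by rw [hFw]; exact hw.mul (huu.pow n)
      exact IsLocalRing.notMem_maximalIdeal.mpr hFunit (Ideal.pow_le_self two_ne_zero hF2)
  -- conclusion
  obtain ⟨h, hh, H⟩ := key
  exact ⟨h, hh, 1, ![u], ![1], fun i => by fin_cases i; exact Nat.one_pos, ⟨hU𝔪, hli𝔪⟩,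
    fun 𝔮 _ hh𝔮 hdim𝔮 => H 𝔮 hh𝔮 hdim𝔮⟩

end JOpenLE3

end Summit.ResolutionOfSingularities.ResolutionOfSingularities.Theorems

end
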